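import Literature.MathematicalPhysics.QuantumFieldTheory.Balaban1983to89.B12NodeKnit

/-!
# [Balaban1987RG1] THEOREM 3 AS PRINTED (`B12.Thm3Printed`) ASSEMBLED from the cluster properties of [Balaban1988RG2Cluster]
# through the small-field tower and the «(or analytic)» chain — the printed quantifier order over the constants made explicit

T. Bałaban, *Renormalization group approach to lattice gauge field theories. I. Generation of effective actions in a small field
approximation and a coupling constant renormalization in four dimensions*, Commun. Math. Phys. **109** (1987) 249–301
[Balaban1987RG1] (cell paper B12 = «[I]»; PDF page = journal page − 248) and *II. Cluster expansions*, Commun. Math. Phys. **116**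
(1988) 1–22 [Balaban1988RG2Cluster] (B13 = «[II]»).

CITATION HEADER (lean-in-tree rule 2026-08-18).  THEOREMS ONLY (0 `def`, 0 `sorry`, axioms ⊆ {propext, Classical.choice, Quot.sound}):
a by-name ASSEMBLY of statements already typed in the tree; nothing of the series is asserted.  WHAT IS REPRODUCED, and nothing else:
**Theorem 3** (p. 264 [PDF 16]), verbatim: *«There exist positive constants κ₀, M(κ), γ, ε₀, ε₁, α₀, α₁ such, that if κ ≥ κ₀,
M ≥ M(κ), 0 < g_k ≤ γ for k = 0, 1, …, K, then the sequence of actions A_k, defined inductively by the small field renormalization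
transformations (0.17)–(0.20), satisfy all the inductive assumptions described between (1.1)–(1.22). The constants ε₀, ε₁, α₀, α₁
depend on M and satisfy numerous restrictions, which will become clear in the proof. The constant γ depends on all other constants.»*
— typed as `B12.Thm3Printed C` (module `…B12`, quantifier order ∃κ₀ ∀κ≥κ₀ ∃M(κ) ∀M≥M(κ) ∃ε₀ε₁α₀α₁>0 ∃γ>0 ∀ runs) for a
constants-indexed construction `C : B12.Consts3 → B12.Construction`; and its printed PROOF STRUCTURE: p. 269 [21] *«Thus the proof
of Theorem 3 is reduced to proving the remaining properties of (2.13), i.e. to a construction of the representation (1.7) with terms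
having the analytic extensions satisfying the bound (1.18).»* + [II] p. 22 *«The above remark completes the proof of the inductive
assumptions for the action A_{k+1}, hence the proof of Theorem I.3.»*.

WHY THIS MODULE.  Before it, the tree had concluding theorems only for the INNERMOST CLAUSE of Theorem 3 at FIXED constants
(`B13.thm3_inner_of_step`, `B12Sec2to5.thm3_inner_of_sec2`, `B12NodeKnit.thm3_inner_of_b12_main`), for the tower SHAPE
(`Step.B12Thm3Shape`, `B12StepObligation.b12Thm3Shape_of_deliverables`) and for Theorem 1 (`B12NodeKnit.thm1Printed_of_b12_main`);
no theorem concluded `B12.Thm3Printed` itself (NODE-TABLE row n09: «`B12.Thm3Printed` has no inhabitant»).  Here: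
* §1 RUN LEVEL — the Theorem-3 CLAUSE `0 < g_k ≤ γ (k ≤ K) → ∀ k ≤ K, IndAss k` for ONE run datum `D : B12.RunData` bound to a
  small-field tower by `B12StepObligation.RunDict` (no world, no carrier pin): from the per-step new-term obligations
  (`thm3Clause_of_runDict_steps`; first step AUTOMATIC, `Step.SFHyp.zero`); from [II]'s delivered clauses per step and coupling value
  (`thm3Clause_of_deliverables`, the chain (iv) of `B12NodeKnit`); from [II] LEMMA 3 per (k, g ∈ ]0, γ]) + the printed closing
  leaves of [II] pp. 20–22 + ONE holomorphic source per step for the new term and for the polarization kernel — THE «(or analytic)»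
  CHAIN of p. 266 (`thm3Clause_of_lemma3Family_eHolo`, via `B12BetaHolo.sfNewTerm_of_deliverables_Ioc`: the endpoint g = 0 by
  continuity, both β-clauses of p. 264 by Cauchy estimates); and from the history-indexed family predicate «Lemmas 1–3 of [II] on the
  coupling box» (`thm3Clause_of_b13Family_eHolo`, via `B13NodeTorusFamily.lemma3_at_update`).
* §2 THE PRINTED QUANTIFIER SHELL — `B12.Thm3Printed C` from the SAME shell with its innermost clause replaced by «first step ∧
  [II]'s node `B13.SmallFieldStep`» (`thm3Printed_of_smallFieldStep`) or by «first step ∧ the §2 reduction `Sec2Reduction` ∧ the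
  delivery `NewTermDelivered`» (`thm3Printed_of_sec2` — p. 269's sentence at the level of the printed theorem); the located VACUITY
  remark `thm3Printed_of_trivial_indAss` (cf. `Node00.b12_main_iff_of_trivial_indAss`: the content is in WHICH `C`).
* §3 THE SCHEDULE (Skolem) READING — `thm3Printed_iff_schedule`: «M(κ)», «ε₀, ε₁, α₀, α₁ depend on M», «γ depends on all other
  constants» as CHOICE FUNCTIONS `Mof`, `cs κ M : Consts3` (pinned to `(κ, M)`), `γ κ M`; the reading is FAITHFUL (an `iff`,
  `Classical.choice`); `thm3Printed_of_schedule`.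
* §4 FROM TOWERS — for constructions bound at every admissible `(κ, M)` and every run to towers `T κ M P` with tower constants
  `sc κ M` (the schedule's γ IS `(sc κ M).γ`): `thm3Printed_of_runDict_steps`, `thm3Printed_of_deliverables`, and the HEADLINES
  **`thm3Printed_of_lemma3Family_eHolo`** ∕ **`thm3Printed_of_b13Family_eHolo`** — `B12.Thm3Printed C` ⇐ [II]'s cluster properties
  via the analyticity chain, every input displayed by name at its printed source.
* §5 `thm1Printed_of_thm3Printed` — Theorem 3 ⇒ Theorem 1 (p. 264 *«a precise version of Theorem 1»*) at the admissible constants.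

CONSTANTS (honesty notes).  (1) The *«numerous restrictions»* stay EXISTENTIAL exactly as in `B12.Thm3Printed`: no print-literal
restriction list is consumed anywhere below — in particular not `B12Sec2to5.Lemma4Restrictions`, which is insufficient for (3.41)
(`B12ExpSteps.lemma4Restrictions_not_sufficient_341`); the [II]-side restrictions enter only as the named leaves `Restr`, `R22`–`R24`
of `B13`.  (2) The tower constants `sc κ M : Step.SFConsts` are the instantiating reader's (`SFConsts.M : ℕ` while `Consts3.M : ℝ`;
print: M = L^m); the dictionary `RunDict` ties only the flow and `IndAss k ↔ SFHyp T c k`.  (3) `γ` may depend on `(κ, M)` but not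
on the run — *«uniform in the lattice spacing ε»* (p. 259) is this quantifier placement.
HONEST FRAMING: count-neutral assembly by name (Track A node N09, seat `pub-ymgap-dag-n09-c`, strategy s1); `B12.Thm3Printed C` is
concluded for constructions `C` whose run data are bound, constants-by-constants and run-by-run, to towers fed by [II]'s deliverables —
WHICH construction is «of record» is NODE 00's definition, not this module's; [Balaban1987RG1] Theorem 2 is not touched.  One finite
four-torus programme at fixed ε; NOT ℝ⁴, NOT infinite volume, NOT OS axioms, NOT a mass gap, NOT the Clay problem.
-/

namespace Literature.MathematicalPhysics.QuantumFieldTheory.Balaban1983to89.B12Thm3Assembly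

open B12StepObligation (RunDict StepDict ConstsCompare SpacesGaugeInvariant Beta542Source BetaSmoothAt
  smallFieldStep_iff_steps rg_of_satisfiesRG)
open Step (SFTower SFConsts SFHyp SFNewTerm)

/-! ## §1. Run level: the Theorem-3 clause for ONE run datum bound to a small-field tower -/

section Run

variable {Q : Params} {G : Type*} [GaugeGroup G] {Φ 𝒢 : Type*} {T : SFTower Q G Φ 𝒢} {c : SFConsts}
  {D : B12.RunData} (hD : RunDict D T c) (K : ℕ)

include hD in
/-- **The Theorem-3 clause of ONE run from the per-step new-term obligations.**  If the run's data `D` are bound to a tower `T` by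
`B12StepObligation.RunDict` (same coupling flow; `IndAss k ↔ Step.SFHyp T c k` — the reading of *«A_k satisfies all the inductive
assumptions described between (1.1)–(1.22)»*, Thm 3 p. 264), then the FIRST STEP is automatic (`Step.SFHyp.zero`: A₀ = −(1∕g₀²)A has
no terms, (0.17)) and the clause *«if 0 < g_k ≤ γ for k = 0, 1, …, K, then … A_k … satisfy all the inductive assumptions»* follows
from the per-step obligations `SFHyp T c k → SFNewTerm T c k` (k < K, couplings in the interval up to k+1) by [II]'s node
(`B12StepObligation.smallFieldStep_iff_steps`, `B13.indAss_all`).  Bookkeeping. [cite: Balaban1987RG1, Thm 3 p.264 with (0.17) p.255; Balaban1988RG2Cluster, p.22 (proof of Thm I.3)] -/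
theorem thm3Clause_of_runDict_steps
    (hsteps : ∀ k, k < K → T.flow.InInterval c.γ (k + 1) → SFHyp T c k → SFNewTerm T c k) :
    D.flow.InInterval c.γ K → ∀ k, k ≤ K → D.IndAss k := fun hI =>
  B13.indAss_all D K c.γ ((hD.indAss_iff 0).2 (SFHyp.zero T c)) ((smallFieldStep_iff_steps hD K).2 hsteps) hI

include hD in
/-- **The Theorem-3 clause of ONE run from [II]'s delivered clauses — the chain (iv) of `B12NodeKnit` without world or pin.**  Per
step `k < K`, GIVEN the inductive hypotheses at `k` and the interval hypothesis up to `k+1` (under which [II] works, p. 1 ∕ p. 18 there):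
[II]'s `B13.Deliverables` for the step data `S k g` at every coupling value `g ∈ [0, γ]` (pp. 15, 21–22), read through the dictionary
`StepDict` in the representation (I.1.6) (`hF`), with comparable constants (`hc`) and the algebraic clauses at every `g` (`hrepr`,
`hgauge`); the couplings generated by (0.20) = (2.15) p. 268 (`hrg`); the spaces `Uᶜ_{k+1}` gauge invariant *«by the definition»*
(p. 263, `hsp`); `β_{k+1}` the second moment (5.42) of a kernel obeying (5.10) (`hβ`); and the UNSOURCED smoothness clause of p. 264
(`hsmooth`, cell GAPS G-b12-2 (ii)).  `B12StepObligation.sfNewTerm_of_deliverables` per step + `thm3Clause_of_runDict_steps`.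
[cite: Balaban1987RG1, Thm 3 p.264, (2.15) p.268, p.263–264, (5.10) p.293, (5.42) p.297; Balaban1988RG2Cluster, pp.15, 21–22] -/
theorem thm3Clause_of_deliverables (S : ℕ → ℝ → B13.StepData) (c13 : B13.Consts)
    (Δ : ∀ k, StepDict T c k (S k)) (hF : ∀ k g, (Δ k).F g = (S k g).Etot) (hc : ConstsCompare c13 c)
    (hdel : ∀ k, k < K → SFHyp T c k → T.flow.InInterval c.γ (k + 1) →
      ∀ g, 0 ≤ g → g ≤ c.γ → B13.Deliverables (S k g) c13)
    (hrepr : ∀ k g, (S k g).Repr17) (hgauge : ∀ k g X, (S k g).GaugeInv ((S k g).Etot X))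
    (hrg : D.flow.SatisfiesRG K)
    (hsp : ∀ k, k < K → SpacesGaugeInvariant T c (k + 1))
    (hβ : ∀ k, k < K → Beta542Source T c k) (hsmooth : ∀ k, k < K → BetaSmoothAt T c k) :
    D.flow.InInterval c.γ K → ∀ k, k ≤ K → D.IndAss k := by
  refine thm3Clause_of_runDict_steps hD K fun k hk hI hH => ?_
  have hrgT : T.flow.SatisfiesRG K := by
    rw [← hD.flow_eq]
    exact hrg
  exact B12StepObligation.sfNewTerm_of_deliverables (Δ k) (hF k) hc (hdel k hk hH hI) (hrepr k) (hgauge k)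
    (rg_of_satisfiesRG hrgT hk) (hsp k hk) (hβ k hk) (hsmooth k hk)

include hD in
/-- **The Theorem-3 clause of ONE run through THE «(or analytic)» CHAIN** (p. 266 *«the functions E^{(j)}, β_j are analytic functions
of the effective coupling constants»*; the chain (iv⁗′) of `B12NodeKnit` without world or pin).  Per step `k < K` and coupling
`g ∈ ]0, γ]` ([II] Lemma 2 p. 11 needs `g_k ≠ 0`), GIVEN the inductive hypotheses at `k` and the interval hypothesis up to `k+1`:
[II] LEMMA 3 for the step data `S k g` (`h3`) + the printed closing leaves of [II] pp. 20–22 — the restrictions (`hR`), the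
[26]-resummation (2.38) ⇒ (2.41) (`h26`), the two *«last assumptions»* and `δ₀M ≥ κ` (`h22 h23 h24`), `0 ≤ E₀`, the `log Z^{(k)}`
half of (I.1.18) (`hlog`, UNPRINTED in the series — GAPS G-B13-12), the representation (I.1.7), analyticity and gauge invariance
(`hrepr han hg`) — assembled by `B13.deliverables_of_chain`; the dictionary in the representation (I.1.6) (`Δ hF hc`); (2.15)
(`hrg`); the spaces gauge invariant by definition (p. 263, `hsp`); `0 < γ` (p. 263 *«a positive, absolute γ»*); and per step ONE
holomorphic source for the new TERM (`hE : EHoloAt` — (1.18) at `g = 0` by continuity) and ONE for the polarization KERNEL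
(`hPi : PiHoloSource` — both β-clauses of p. 264 by Cauchy estimates): `B12BetaHolo.sfNewTerm_of_deliverables_Ioc` per step.
[cite: Balaban1987RG1, Thm 3 p.264, (1.18) p.263, p.266 (analytic alternative), (2.15) p.268; Balaban1988RG2Cluster, Lemma 3 p.20 and pp.20–22] -/
theorem thm3Clause_of_lemma3Family_eHolo (hγ0 : 0 < c.γ) (S : ℕ → ℝ → B13.StepData) (c13 : B13.Consts)
    (Δ : ∀ k, StepDict T c k (S k)) (hF : ∀ k g, (Δ k).F g = (S k g).Etot) (hc : ConstsCompare c13 c)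
    (h3 : ∀ k, k < K → SFHyp T c k → T.flow.InInterval c.γ (k + 1) →
      ∀ g, 0 < g → g ≤ c.γ → B13.Lemma3Printed (S k g) c13)
    (hR : ∀ k g, (S k g).Restr) (h26 : ∀ k g, B13.CammarotaStep (S k g) c13)
    (h22 : c13.R22) (h23 : c13.R23) (h24 : c13.R24) (hE₀ : 0 ≤ c13.E₀)
    (hlog : ∀ k g, B13.Bound118 (S k g).Dk1 (S k g).sp2 (S k g).Elog (c13.E₀ / 2) (c13.δ₀ * c13.M))
    (hrepr : ∀ k g, (S k g).Repr17) (han : ∀ k g X, (S k g).Analytic ((S k g).Etot X) ((S k g).sp2 X))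
    (hg : ∀ k g X, (S k g).GaugeInv ((S k g).Etot X))
    (hrg : D.flow.SatisfiesRG K)
    (hsp : ∀ k, k < K → SpacesGaugeInvariant T c (k + 1))
    (hE : ∀ k, k < K → B12BetaHolo.EHoloAt T c k) (hPi : ∀ k, k < K → B12BetaHolo.PiHoloSource T c k) :
    D.flow.InInterval c.γ K → ∀ k, k ≤ K → D.IndAss k := by
  refine thm3Clause_of_runDict_steps hD K fun k hk hI hH => ?_
  have hrgT : T.flow.SatisfiesRG K := by
    rw [← hD.flow_eq]
    exact hrg
  exact B12BetaHolo.sfNewTerm_of_deliverables_Ioc (Δ k) (hF k) hc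
    (fun g hg0 hgγ => B13.deliverables_of_chain (S k g) c13 (hR k g) (h3 k hk hH hI g hg0 hgγ) (h26 k g) h22 h23 h24 hE₀
      (hlog k g) (hrepr k g) (han k g) (hg k g))
    (hrepr k) (hg k) (rg_of_satisfiesRG hrgT hk) (hsp k hk) hγ0 (hE k hk) (hPi k hk)

include hD in
/-- **The Theorem-3 clause of ONE run FROM THE CLUSTER PROPERTIES OF [II] AS A FAMILY STATEMENT** (the chain (iv⁵) of `B12NodeKnit`
without world or pin).  Let `S13 k v` be [II]'s step data as a function of the coupling HISTORY `v = (g_0, …, g_k)` (p. 298 *«β_j …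
depends also on all preceding coupling constants»*) and suppose LEMMAS 1–3 of [II] (pp. 9, 11, 20) hold on the box `]0, γ₁₃]^{k+1}`
(`hfam`, with `γ ≤ γ₁₃`).  Reading the per-(k, g) step family as the run's history with the LAST coupling replaced by the variable `g`
(`S k g := S13 k (update (prefixOf g_· k) (last k) g)`, the currency of (1.18) ∕ (5.42)), the Lemma-3 slot of
`thm3Clause_of_lemma3Family_eHolo` is `B13NodeTorusFamily.lemma3_at_update`, and the clause follows from the remaining closing
leaves, the dictionary, (2.15), the spaces, `0 < γ`, and per step ONE `EHoloAt` + ONE `PiHoloSource`.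
[cite: Balaban1987RG1, Thm 3 p.264, p.266, p.298; Balaban1988RG2Cluster, Lemmas 1–3 pp.9, 11, 20 and pp.20–22] -/
theorem thm3Clause_of_b13Family_eHolo (hγ0 : 0 < c.γ)
    (S13 : (k : ℕ) → (Fin (k + 1) → ℝ) → B13.StepData) (c13 : B13.Consts) {γ13 : ℝ} (hγ13 : c.γ ≤ γ13)
    (hfam : ∀ k v, v ∈ FlowStep.Box γ13 k →
      B13.Lemma1Printed (S13 k v) c13 ∧ B13.Lemma2Printed (S13 k v) c13 ∧ B13.Lemma3Printed (S13 k v) c13)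
    (Δ : ∀ k, StepDict T c k (fun g => S13 k (Function.update (FlowStep.prefixOf T.flow.g k) (Fin.last k) g)))
    (hF : ∀ k g, (Δ k).F g = (S13 k (Function.update (FlowStep.prefixOf T.flow.g k) (Fin.last k) g)).Etot)
    (hc : ConstsCompare c13 c)
    (hR : ∀ k v, (S13 k v).Restr) (h26 : ∀ k v, B13.CammarotaStep (S13 k v) c13)
    (h22 : c13.R22) (h23 : c13.R23) (h24 : c13.R24) (hE₀ : 0 ≤ c13.E₀)
    (hlog : ∀ k v, B13.Bound118 (S13 k v).Dk1 (S13 k v).sp2 (S13 k v).Elog (c13.E₀ / 2) (c13.δ₀ * c13.M))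
    (hrepr : ∀ k v, (S13 k v).Repr17) (han : ∀ k v X, (S13 k v).Analytic ((S13 k v).Etot X) ((S13 k v).sp2 X))
    (hg : ∀ k v X, (S13 k v).GaugeInv ((S13 k v).Etot X))
    (hrg : D.flow.SatisfiesRG K)
    (hsp : ∀ k, k < K → SpacesGaugeInvariant T c (k + 1))
    (hE : ∀ k, k < K → B12BetaHolo.EHoloAt T c k) (hPi : ∀ k, k < K → B12BetaHolo.PiHoloSource T c k) :
    D.flow.InInterval c.γ K → ∀ k, k ≤ K → D.IndAss k :=
  thm3Clause_of_lemma3Family_eHolo hD K hγ0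
    (fun k g => S13 k (Function.update (FlowStep.prefixOf T.flow.g k) (Fin.last k) g)) c13 Δ hF hc
    (fun _ _ _ hI => B13NodeTorusFamily.lemma3_at_update hγ13 S13 c13 hfam (fun i hi => hI i (Nat.le_succ_of_le hi)))
    (fun k _ => hR k _) (fun k _ => h26 k _) h22 h23 h24 hE₀ (fun k _ => hlog k _) (fun k _ => hrepr k _)
    (fun k _ X => han k _ X) (fun k _ X => hg k _ X) hrg hsp hE hPi

end Run

/-! ## §2. The printed quantifier shell of Theorem 3 with the cluster properties as its innermost clause -/

section Shell

variable (C : B12.Consts3 → B12.Construction)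

/-- **THEOREM 3 AS PRINTED from the first step and [II]'s node, in the printed quantifier order.**  Reading *«There exist positive
constants κ₀, M(κ), γ, ε₀, ε₁, α₀, α₁ such, that if κ ≥ κ₀, M ≥ M(κ), 0 < g_k ≤ γ for k = 0, 1, …, K, then …»* (p. 264) with the
SAME quantifier shell as `B12.Thm3Printed` (∃κ₀ ∀κ ∃M(κ) ∀M ∃ε₀ε₁α₀α₁ ∃γ ∀ runs) but with the innermost clause replaced by «the
first step `IndAss 0` under the interval hypothesis ((0.17): A₀ has no terms) ∧ the small-field inductive step `B13.SmallFieldStep`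
of the run» ([II] p. 22 *«hence the proof of Theorem I.3»*), Theorem 3 follows by induction on `k` (`B13.thm3_inner_of_step`).
Pure logic over the typed statements. [cite: Balaban1987RG1, Thm 3 p.264; Balaban1988RG2Cluster, p.22 (proof of Thm I.3)] -/
theorem thm3Printed_of_smallFieldStep
    (h : ∃ κ₀ : ℝ, 0 < κ₀ ∧ ∀ κ : ℝ, κ₀ ≤ κ → ∃ Mκ : ℝ, 0 < Mκ ∧ ∀ M : ℝ, Mκ ≤ M →
      ∃ ε₀ ε₁ α₀ α₁ : ℝ, 0 < ε₀ ∧ 0 < ε₁ ∧ 0 < α₀ ∧ 0 < α₁ ∧ ∃ γ : ℝ, 0 < γ ∧ ∀ P : B12.RunParams,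
        ((C ⟨κ, M, ε₀, ε₁, α₀, α₁⟩ P).flow.InInterval γ P.K → (C ⟨κ, M, ε₀, ε₁, α₀, α₁⟩ P).IndAss 0) ∧
          B13.SmallFieldStep (C ⟨κ, M, ε₀, ε₁, α₀, α₁⟩ P) P.K γ) :
    B12.Thm3Printed C := by
  obtain ⟨κ₀, hκ₀, h⟩ := h
  refine ⟨κ₀, hκ₀, fun κ hκ => ?_⟩
  obtain ⟨Mκ, hMκ, h⟩ := h κ hκ
  refine ⟨Mκ, hMκ, fun M hM => ?_⟩
  obtain ⟨ε₀, ε₁, α₀, α₁, hε₀, hε₁, hα₀, hα₁, γ, hγ, h⟩ := h M hM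
  exact ⟨ε₀, ε₁, α₀, α₁, hε₀, hε₁, hα₀, hα₁, γ, hγ,
    B13.thm3_inner_of_step C ⟨κ, M, ε₀, ε₁, α₀, α₁⟩ γ (fun P => (h P).1) fun P => (h P).2⟩

/-- **THEOREM 3 AS PRINTED from the §2 REDUCTION of [I]** (p. 268 [20] *«By the inductive assumption, and by the properties of the
expressions given by explicit formulas, all terms in this representation satisfy the required properties, except possibly the last term
(2.13) in the sum.»*, p. 269 [21] *«Thus the proof of Theorem 3 is reduced to proving the remaining properties of (2.13), i.e. to a
construction of the representation (1.7) with terms having the analytic extensions satisfying the bound (1.18).»*): in the printed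
quantifier order, for ANY reading `NewTerm P (k+1)` of «(2.13) has the representation (1.7) with analytic terms satisfying (1.18)» at
the admissible constants, the first step + `B12Sec2to5.Sec2Reduction` + the delivery `B12Sec2to5.NewTermDelivered` (the content of
§§3–5 of [I] and of [II]) give `B12.Thm3Printed C` (`B12Sec2to5.thm3_inner_of_sec2`).  Pure logic over the typed statements.
[cite: Balaban1987RG1, §2 pp.268–269 (reduction of Thm 3 to (2.13)) with Thm 3 p.264] -/
theorem thm3Printed_of_sec2
    (h : ∃ κ₀ : ℝ, 0 < κ₀ ∧ ∀ κ : ℝ, κ₀ ≤ κ → ∃ Mκ : ℝ, 0 < Mκ ∧ ∀ M : ℝ, Mκ ≤ M →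
      ∃ ε₀ ε₁ α₀ α₁ : ℝ, 0 < ε₀ ∧ 0 < ε₁ ∧ 0 < α₀ ∧ 0 < α₁ ∧ ∃ γ : ℝ, 0 < γ ∧
        ∃ NewTerm : B12.RunParams → ℕ → Prop, ∀ P : B12.RunParams,
          ((C ⟨κ, M, ε₀, ε₁, α₀, α₁⟩ P).flow.InInterval γ P.K → (C ⟨κ, M, ε₀, ε₁, α₀, α₁⟩ P).IndAss 0) ∧
            B12Sec2to5.Sec2Reduction (C ⟨κ, M, ε₀, ε₁, α₀, α₁⟩ P) (NewTerm P) P.K γ ∧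
              B12Sec2to5.NewTermDelivered (C ⟨κ, M, ε₀, ε₁, α₀, α₁⟩ P) (NewTerm P) P.K γ) :
    B12.Thm3Printed C := by
  obtain ⟨κ₀, hκ₀, h⟩ := h
  refine ⟨κ₀, hκ₀, fun κ hκ => ?_⟩
  obtain ⟨Mκ, hMκ, h⟩ := h κ hκ
  refine ⟨Mκ, hMκ, fun M hM => ?_⟩
  obtain ⟨ε₀, ε₁, α₀, α₁, hε₀, hε₁, hα₀, hα₁, γ, hγ, NewTerm, h⟩ := h M hM
  exact ⟨ε₀, ε₁, α₀, α₁, hε₀, hε₁, hα₀, hα₁, γ, hγ,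
    B12Sec2to5.thm3_inner_of_sec2 C ⟨κ, M, ε₀, ε₁, α₀, α₁⟩ γ NewTerm (fun P => (h P).1) (fun P => (h P).2.1)
      fun P => (h P).2.2⟩

/-- LOCATED VACUITY REMARK (bookkeeping, cf. `Node00.b12_main_iff_of_trivial_indAss`): a constants-indexed construction whose
predicate `IndAss` is everywhere true inhabits `B12.Thm3Printed` with all constants `1` — the typed statement is consistent and its
content lies ENTIRELY in WHICH construction `C` it is applied to (the construction of record is NODE 00's definition, not a choice made
here).  Pure logic. [cite: Balaban1987RG1, Thm 3 p.264 (statement shape only)] -/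
theorem thm3Printed_of_trivial_indAss (h : ∀ c P k, (C c P).IndAss k) : B12.Thm3Printed C :=
  ⟨1, one_pos, fun _ _ => ⟨1, one_pos, fun _ _ =>
    ⟨1, 1, 1, 1, one_pos, one_pos, one_pos, one_pos, 1, one_pos, fun P _ k _ => h _ P k⟩⟩⟩

end Shell

/-! ## §3. The schedule reading: M(κ), the constants at (κ, M) and γ as choice functions -/

section Schedule

variable (C : B12.Consts3 → B12.Construction)

/-- The six constants at `(κ, M)` written as a `B12.Consts3` whose first two fields ARE `κ` and `M` (structure eta). [folklore] -/
private theorem consts3_eq (c : B12.Consts3) {κ M : ℝ} (hκ : c.κ = κ) (hM : c.M = M) :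
    (⟨κ, M, c.ε₀, c.ε₁, c.α₀, c.α₁⟩ : B12.Consts3) = c := by
  cases c
  cases hκ
  cases hM
  rfl

/-- **THE SCHEDULE FORM OF THEOREM 3.**  Given a threshold `κ₀ > 0`, a positive function `M(κ)` (*«M ≥ M(κ)»*), admissible constants
`cs κ M : Consts3` pinned to `(κ, M)` with `ε₀, ε₁, α₀, α₁ > 0` (*«The constants ε₀, ε₁, α₀, α₁ depend on M»*) and `γ(κ, M) > 0`
(*«The constant γ depends on all other constants»*), the Theorem-3 clause at every admissible `(κ, M)` and every run gives
`B12.Thm3Printed C`.  Pure logic (the printed dependences as function arguments). [cite: Balaban1987RG1, Thm 3 p.264 (dependence of the constants)] -/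
theorem thm3Printed_of_schedule {κ₀ : ℝ} {Mof : ℝ → ℝ} {cs : ℝ → ℝ → B12.Consts3} (γ : ℝ → ℝ → ℝ)
    (hκ₀ : 0 < κ₀) (hMof : ∀ κ, κ₀ ≤ κ → 0 < Mof κ)
    (hcs : ∀ κ M, κ₀ ≤ κ → Mof κ ≤ M →
      (cs κ M).κ = κ ∧ (cs κ M).M = M ∧ 0 < (cs κ M).ε₀ ∧ 0 < (cs κ M).ε₁ ∧ 0 < (cs κ M).α₀ ∧ 0 < (cs κ M).α₁)
    (hγ : ∀ κ M, κ₀ ≤ κ → Mof κ ≤ M → 0 < γ κ M)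
    (hrun : ∀ κ M, κ₀ ≤ κ → Mof κ ≤ M → ∀ P : B12.RunParams,
      (C (cs κ M) P).flow.InInterval (γ κ M) P.K → ∀ k, k ≤ P.K → (C (cs κ M) P).IndAss k) :
    B12.Thm3Printed C := by
  refine ⟨κ₀, hκ₀, fun κ hκ => ⟨Mof κ, hMof κ hκ, fun M hM => ?_⟩⟩
  obtain ⟨hk, hm, hε₀, hε₁, hα₀, hα₁⟩ := hcs κ M hκ hM
  refine ⟨(cs κ M).ε₀, (cs κ M).ε₁, (cs κ M).α₀, (cs κ M).α₁, hε₀, hε₁, hα₀, hα₁, γ κ M, hγ κ M hκ hM, ?_⟩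
  rw [consts3_eq (cs κ M) hk hm]
  exact hrun κ M hκ hM

/-- **THE SCHEDULE READING IS FAITHFUL**: `B12.Thm3Printed C` is EQUIVALENT to the existence of a schedule — a threshold `κ₀ > 0`, a
positive `M(κ)` on `κ ≥ κ₀`, constants `cs κ M : Consts3` pinned to `(κ, M)` with positive `ε₀ ε₁ α₀ α₁`, and `γ(κ, M) > 0` — under
which the Theorem-3 clause holds at every admissible `(κ, M)` and every run.  (→: Skolemisation by `Classical.choice`, with junk
values `1` off the admissible region; ←: `thm3Printed_of_schedule`.)  This is the reading of *«M(κ)»*, *«ε₀, ε₁, α₀, α₁ depend on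
M»*, *«γ depends on all other constants»* as functions, certified against the typed quantifier order. [cite: Balaban1987RG1, Thm 3 p.264 (dependence of the constants)] -/
theorem thm3Printed_iff_schedule :
    B12.Thm3Printed C ↔
      ∃ (κ₀ : ℝ) (Mof : ℝ → ℝ) (cs : ℝ → ℝ → B12.Consts3) (γ : ℝ → ℝ → ℝ),
        0 < κ₀ ∧ (∀ κ, κ₀ ≤ κ → 0 < Mof κ) ∧
        (∀ κ M, κ₀ ≤ κ → Mof κ ≤ M → (cs κ M).κ = κ ∧ (cs κ M).M = M ∧
          0 < (cs κ M).ε₀ ∧ 0 < (cs κ M).ε₁ ∧ 0 < (cs κ M).α₀ ∧ 0 < (cs κ M).α₁) ∧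
        (∀ κ M, κ₀ ≤ κ → Mof κ ≤ M → 0 < γ κ M) ∧
        ∀ κ M, κ₀ ≤ κ → Mof κ ≤ M → ∀ P : B12.RunParams,
          (C (cs κ M) P).flow.InInterval (γ κ M) P.K → ∀ k, k ≤ P.K → (C (cs κ M) P).IndAss k := by
  classical
  constructor
  · rintro ⟨κ₀, hκ₀, h⟩
    -- Skolemise `M(κ)` (junk value `1` below the threshold)
    have hM : ∀ κ : ℝ, ∃ Mκ : ℝ, 0 < Mκ ∧ (κ₀ ≤ κ → ∀ M : ℝ, Mκ ≤ M →
        ∃ ε₀ ε₁ α₀ α₁ : ℝ, 0 < ε₀ ∧ 0 < ε₁ ∧ 0 < α₀ ∧ 0 < α₁ ∧ ∃ γ : ℝ, 0 < γ ∧ ∀ P : B12.RunParams,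
          (C ⟨κ, M, ε₀, ε₁, α₀, α₁⟩ P).flow.InInterval γ P.K → ∀ k, k ≤ P.K → (C ⟨κ, M, ε₀, ε₁, α₀, α₁⟩ P).IndAss k) := by
      intro κ
      by_cases hκ : κ₀ ≤ κ
      · obtain ⟨Mκ, hMκ, h'⟩ := h κ hκ
        exact ⟨Mκ, hMκ, fun _ => h'⟩
      · exact ⟨1, one_pos, fun h' => absurd h' hκ⟩
    choose Mof hMpos hM using hM
    -- Skolemise the constants at `(κ, M)` (junk values `1` off the admissible region)
    have hc : ∀ κ M : ℝ, ∃ ε₀ ε₁ α₀ α₁ γ : ℝ, 0 < ε₀ ∧ 0 < ε₁ ∧ 0 < α₀ ∧ 0 < α₁ ∧ 0 < γ ∧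
        (κ₀ ≤ κ → Mof κ ≤ M → ∀ P : B12.RunParams,
          (C ⟨κ, M, ε₀, ε₁, α₀, α₁⟩ P).flow.InInterval γ P.K → ∀ k, k ≤ P.K → (C ⟨κ, M, ε₀, ε₁, α₀, α₁⟩ P).IndAss k) := by
      intro κ M
      by_cases hκ : κ₀ ≤ κ
      · by_cases hMle : Mof κ ≤ M
        · obtain ⟨ε₀, ε₁, α₀, α₁, hε₀, hε₁, hα₀, hα₁, γ, hγ, h'⟩ := hM κ hκ M hMle
          exact ⟨ε₀, ε₁, α₀, α₁, γ, hε₀, hε₁, hα₀, hα₁, hγ, fun _ _ => h'⟩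
        · exact ⟨1, 1, 1, 1, 1, one_pos, one_pos, one_pos, one_pos, one_pos, fun _ h' => absurd h' hMle⟩
      · exact ⟨1, 1, 1, 1, 1, one_pos, one_pos, one_pos, one_pos, one_pos, fun h' => absurd h' hκ⟩
    choose ε₀ ε₁ α₀ α₁ γ hε₀ hε₁ hα₀ hα₁ hγ hrun using hc
    exact ⟨κ₀, Mof, fun κ M => ⟨κ, M, ε₀ κ M, ε₁ κ M, α₀ κ M, α₁ κ M⟩, γ, hκ₀, fun κ _ => hMpos κ,
      fun κ M _ _ => ⟨rfl, rfl, hε₀ κ M, hε₁ κ M, hα₀ κ M, hα₁ κ M⟩, fun κ M _ _ => hγ κ M,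
      fun κ M hκ hMle => hrun κ M hκ hMle⟩
  · rintro ⟨κ₀, Mof, cs, γ, hκ₀, hMof, hcs, hγ, hrun⟩
    exact thm3Printed_of_schedule C γ hκ₀ hMof hcs hγ hrun

end Schedule

/-! ## §4. Theorem 3 as printed from towers fed by [II]: the schedule carried by tower families `T κ M P`, `sc κ M` -/

section Towers

variable (C : B12.Consts3 → B12.Construction) {κ₀ : ℝ} {Mof : ℝ → ℝ} {cs : ℝ → ℝ → B12.Consts3}
  {Q : ℝ → ℝ → B12.RunParams → Params} {G : Type*} [GaugeGroup G] {Φ 𝒢 : ℝ → ℝ → B12.RunParams → Type*}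
  (T : ∀ κ M P, SFTower (Q κ M P) G (Φ κ M P) (𝒢 κ M P)) (sc : ℝ → ℝ → SFConsts)
  (hκ₀ : 0 < κ₀) (hMof : ∀ κ, κ₀ ≤ κ → 0 < Mof κ)
  (hcs : ∀ κ M, κ₀ ≤ κ → Mof κ ≤ M →
    (cs κ M).κ = κ ∧ (cs κ M).M = M ∧ 0 < (cs κ M).ε₀ ∧ 0 < (cs κ M).ε₁ ∧ 0 < (cs κ M).α₀ ∧ 0 < (cs κ M).α₁)
  (hD : ∀ κ M, κ₀ ≤ κ → Mof κ ≤ M → ∀ P : B12.RunParams, RunDict (C (cs κ M) P) (T κ M P) (sc κ M))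
  (hγ : ∀ κ M, κ₀ ≤ κ → Mof κ ≤ M → 0 < (sc κ M).γ)

include hκ₀ hMof hcs hD hγ

/-- **THEOREM 3 AS PRINTED FROM THE PER-STEP OBLIGATIONS OF TOWERS.**  If at every admissible `(κ, M)` (`κ ≥ κ₀`, `M ≥ M(κ)`) and every
run `P` the construction's data `C (cs κ M) P` are bound to a small-field tower `T κ M P` with tower constants `sc κ M`
(`B12StepObligation.RunDict`; the schedule's γ IS `(sc κ M).γ > 0`, uniform in the run — p. 259 *«uniform in the lattice spacing
ε»*), then the per-step new-term obligations `SFHyp → SFNewTerm` (k < K, couplings `0 < g_j ≤ γ`, j ≤ k+1) give `B12.Thm3Printed C`;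
the first step is automatic.  `thm3Clause_of_runDict_steps` ∘ `thm3Printed_of_schedule`. [cite: Balaban1987RG1, Thm 3 p.264 with §2 pp.268–269; Balaban1988RG2Cluster, p.22] -/
theorem thm3Printed_of_runDict_steps
    (hsteps : ∀ κ M, κ₀ ≤ κ → Mof κ ≤ M → ∀ (P : B12.RunParams) (k : ℕ), k < P.K →
      (T κ M P).flow.InInterval (sc κ M).γ (k + 1) → SFHyp (T κ M P) (sc κ M) k → SFNewTerm (T κ M P) (sc κ M) k) :
    B12.Thm3Printed C :=
  thm3Printed_of_schedule C (fun κ M => (sc κ M).γ) hκ₀ hMof hcs hγ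
    fun κ M hκ hM P => thm3Clause_of_runDict_steps (hD κ M hκ hM P) P.K (hsteps κ M hκ hM P)

/-- **THEOREM 3 AS PRINTED FROM [II]'s DELIVERED CLAUSES** (the chain (iv) at the level of the printed theorem).  At every admissible
`(κ, M)` and every run: the step data `S κ M P k g` of [II] with their dictionaries to the tower in the representation (I.1.6)
(`Δ`, `hF`), [II] constants `c13 κ M` comparable with the tower's (`hc`), [II]'s `B13.Deliverables` per step GIVEN the hypotheses at
`k` and the interval up to `k+1`, at every `g ∈ [0, γ]` (`hdel`, pp. 15, 21–22), the algebraic clauses (`hrepr hgauge`), the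
couplings generated by (0.20) = (2.15) (`hrg`), the spaces gauge invariant by definition (p. 263, `hsp`), the §5 source of the β-bound
((5.42) + (5.10), `hβ`) and the UNSOURCED smoothness clause of p. 264 (`hsmooth`) ⇒ `B12.Thm3Printed C`.
[cite: Balaban1987RG1, Thm 3 p.264, (2.15) p.268, p.263–264, (5.10) p.293, (5.42) p.297; Balaban1988RG2Cluster, pp.15, 21–22] -/
theorem thm3Printed_of_deliverables
    (S : ∀ (κ M : ℝ) (P : B12.RunParams), ℕ → ℝ → B13.StepData) (c13 : ℝ → ℝ → B13.Consts)
    (Δ : ∀ κ M P k, StepDict (T κ M P) (sc κ M) k (S κ M P k))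
    (hF : ∀ κ M P k g, (Δ κ M P k).F g = (S κ M P k g).Etot)
    (hc : ∀ κ M, κ₀ ≤ κ → Mof κ ≤ M → ConstsCompare (c13 κ M) (sc κ M))
    (hdel : ∀ κ M, κ₀ ≤ κ → Mof κ ≤ M → ∀ (P : B12.RunParams) (k : ℕ), k < P.K → SFHyp (T κ M P) (sc κ M) k →
      (T κ M P).flow.InInterval (sc κ M).γ (k + 1) →
        ∀ g, 0 ≤ g → g ≤ (sc κ M).γ → B13.Deliverables (S κ M P k g) (c13 κ M))
    (hrepr : ∀ κ M P k g, (S κ M P k g).Repr17)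
    (hgauge : ∀ κ M P k g X, (S κ M P k g).GaugeInv ((S κ M P k g).Etot X))
    (hrg : ∀ κ M, κ₀ ≤ κ → Mof κ ≤ M → ∀ P : B12.RunParams, (C (cs κ M) P).flow.SatisfiesRG P.K)
    (hsp : ∀ κ M, κ₀ ≤ κ → Mof κ ≤ M → ∀ (P : B12.RunParams) (k : ℕ), k < P.K →
      SpacesGaugeInvariant (T κ M P) (sc κ M) (k + 1))
    (hβ : ∀ κ M, κ₀ ≤ κ → Mof κ ≤ M → ∀ (P : B12.RunParams) (k : ℕ), k < P.K → Beta542Source (T κ M P) (sc κ M) k)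
    (hsmooth : ∀ κ M, κ₀ ≤ κ → Mof κ ≤ M → ∀ (P : B12.RunParams) (k : ℕ), k < P.K → BetaSmoothAt (T κ M P) (sc κ M) k) :
    B12.Thm3Printed C :=
  thm3Printed_of_schedule C (fun κ M => (sc κ M).γ) hκ₀ hMof hcs hγ fun κ M hκ hM P =>
    thm3Clause_of_deliverables (hD κ M hκ hM P) P.K (S κ M P) (c13 κ M) (Δ κ M P) (hF κ M P) (hc κ M hκ hM)
      (hdel κ M hκ hM P) (hrepr κ M P) (hgauge κ M P) (hrg κ M hκ hM P) (hsp κ M hκ hM P) (hβ κ M hκ hM P)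
      (hsmooth κ M hκ hM P)

/-- **HEADLINE — THEOREM 3 AS PRINTED ⇐ THE CLUSTER PROPERTIES OF [II] VIA THE «(or analytic)» CHAIN.**  `B12.Thm3Printed C` holds for
a constants-indexed construction `C` as soon as, at every admissible `(κ, M)` (`κ ≥ κ₀ > 0`, `M ≥ M(κ) > 0`, constants `cs κ M` pinned
to `(κ, M)` with positive `ε₀ ε₁ α₀ α₁`) and every run `P`, the run data are bound to a tower `T κ M P` (`RunDict`, `γ = (sc κ M).γ > 0`)
for which — per step `k < K` and coupling `g ∈ ]0, γ]`, GIVEN the inductive hypotheses at `k` and `0 < g_j ≤ γ` (j ≤ k+1) — [II]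
LEMMA 3 (p. 20) holds for the step data `S κ M P k g` (`h3`), together with the printed closing leaves of [II] pp. 20–22 (`hR` the
restrictions, `h26` the [26]-step (2.38) ⇒ (2.41), `h22 h23 h24` the two «last assumptions» and `δ₀M ≥ κ`, `hE₀`, `hlog` the
`log Z^{(k)}` half of (I.1.18) — UNPRINTED, GAPS G-B13-12 —, `hrepr han hg` the representation (I.1.7), analyticity, gauge invariance),
the dictionary in the representation (I.1.6) (`Δ hF hc`), the couplings generated by (0.20) = (2.15) (`hrg`), the spaces `Uᶜ_{k+1}`
gauge invariant by definition (p. 263, `hsp`), and per step ONE holomorphic source for the new TERM (`hE`, (1.18) at g = 0 by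
continuity) and ONE for the polarization KERNEL (`hPi`, both β-clauses of p. 264 — the p. 266 analytic alternative).  Every input is a
hypothesis named by its printed source; the constants' *«numerous restrictions»* stay existential (no print-literal list is used).
Kernel-checked composition `thm3Clause_of_lemma3Family_eHolo` ∘ `thm3Printed_of_schedule`.
[cite: Balaban1987RG1, Thm 3 p.264, (1.18) p.263, p.266 (analytic alternative), (2.15) p.268, §2 p.269; Balaban1988RG2Cluster, Lemma 3 p.20, pp.20–22, p.22] -/
theorem thm3Printed_of_lemma3Family_eHolo
    (S : ∀ (κ M : ℝ) (P : B12.RunParams), ℕ → ℝ → B13.StepData) (c13 : ℝ → ℝ → B13.Consts)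
    (Δ : ∀ κ M P k, StepDict (T κ M P) (sc κ M) k (S κ M P k))
    (hF : ∀ κ M P k g, (Δ κ M P k).F g = (S κ M P k g).Etot)
    (hc : ∀ κ M, κ₀ ≤ κ → Mof κ ≤ M → ConstsCompare (c13 κ M) (sc κ M))
    (h3 : ∀ κ M, κ₀ ≤ κ → Mof κ ≤ M → ∀ (P : B12.RunParams) (k : ℕ), k < P.K → SFHyp (T κ M P) (sc κ M) k →
      (T κ M P).flow.InInterval (sc κ M).γ (k + 1) →
        ∀ g, 0 < g → g ≤ (sc κ M).γ → B13.Lemma3Printed (S κ M P k g) (c13 κ M))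
    (hR : ∀ κ M P k g, (S κ M P k g).Restr)
    (h26 : ∀ κ M, κ₀ ≤ κ → Mof κ ≤ M → ∀ P k g, B13.CammarotaStep (S κ M P k g) (c13 κ M))
    (h22 : ∀ κ M, κ₀ ≤ κ → Mof κ ≤ M → (c13 κ M).R22) (h23 : ∀ κ M, κ₀ ≤ κ → Mof κ ≤ M → (c13 κ M).R23)
    (h24 : ∀ κ M, κ₀ ≤ κ → Mof κ ≤ M → (c13 κ M).R24) (hE₀ : ∀ κ M, κ₀ ≤ κ → Mof κ ≤ M → 0 ≤ (c13 κ M).E₀)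
    (hlog : ∀ κ M, κ₀ ≤ κ → Mof κ ≤ M → ∀ P k g,
      B13.Bound118 (S κ M P k g).Dk1 (S κ M P k g).sp2 (S κ M P k g).Elog ((c13 κ M).E₀ / 2) ((c13 κ M).δ₀ * (c13 κ M).M))
    (hrepr : ∀ κ M P k g, (S κ M P k g).Repr17)
    (han : ∀ κ M P k g X, (S κ M P k g).Analytic ((S κ M P k g).Etot X) ((S κ M P k g).sp2 X))
    (hg : ∀ κ M P k g X, (S κ M P k g).GaugeInv ((S κ M P k g).Etot X))
    (hrg : ∀ κ M, κ₀ ≤ κ → Mof κ ≤ M → ∀ P : B12.RunParams, (C (cs κ M) P).flow.SatisfiesRG P.K)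
    (hsp : ∀ κ M, κ₀ ≤ κ → Mof κ ≤ M → ∀ (P : B12.RunParams) (k : ℕ), k < P.K →
      SpacesGaugeInvariant (T κ M P) (sc κ M) (k + 1))
    (hE : ∀ κ M, κ₀ ≤ κ → Mof κ ≤ M → ∀ (P : B12.RunParams) (k : ℕ), k < P.K → B12BetaHolo.EHoloAt (T κ M P) (sc κ M) k)
    (hPi : ∀ κ M, κ₀ ≤ κ → Mof κ ≤ M → ∀ (P : B12.RunParams) (k : ℕ), k < P.K →
      B12BetaHolo.PiHoloSource (T κ M P) (sc κ M) k) :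
    B12.Thm3Printed C :=
  thm3Printed_of_schedule C (fun κ M => (sc κ M).γ) hκ₀ hMof hcs hγ fun κ M hκ hM P =>
    thm3Clause_of_lemma3Family_eHolo (hD κ M hκ hM P) P.K (hγ κ M hκ hM) (S κ M P) (c13 κ M) (Δ κ M P) (hF κ M P)
      (hc κ M hκ hM) (h3 κ M hκ hM P) (hR κ M P) (h26 κ M hκ hM P) (h22 κ M hκ hM) (h23 κ M hκ hM) (h24 κ M hκ hM)
      (hE₀ κ M hκ hM) (hlog κ M hκ hM P) (hrepr κ M P) (han κ M P) (hg κ M P) (hrg κ M hκ hM P) (hsp κ M hκ hM P)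
      (hE κ M hκ hM P) (hPi κ M hκ hM P)

/-- **HEADLINE (family form) — THEOREM 3 AS PRINTED FROM LEMMAS 1–3 OF [II] AS A STATEMENT ON THE COUPLING BOX.**  As
`thm3Printed_of_lemma3Family_eHolo`, with [II]'s step data given as functions `S13 κ M P k v` of the coupling HISTORY `v` and the
cluster properties as the family predicate «Lemma 1 ∧ Lemma 2 ∧ Lemma 3 of [II] for `S13 κ M P k v`, `v ∈ ]0, γ₁₃]^{k+1}`» (`hfam`,
`γ ≤ γ₁₃(κ, M)`; pp. 9, 11, 20) — the per-(k, g) data being the run's history with the last coupling as the variable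
(`B13NodeTorusFamily.lemma3_at_update`). [cite: Balaban1987RG1, Thm 3 p.264, p.266, p.298; Balaban1988RG2Cluster, Lemmas 1–3 pp.9, 11, 20 and pp.20–22] -/
theorem thm3Printed_of_b13Family_eHolo
    (S13 : ∀ (κ M : ℝ) (P : B12.RunParams) (k : ℕ), (Fin (k + 1) → ℝ) → B13.StepData) (c13 : ℝ → ℝ → B13.Consts)
    (γ13 : ℝ → ℝ → ℝ) (hγ13 : ∀ κ M, κ₀ ≤ κ → Mof κ ≤ M → (sc κ M).γ ≤ γ13 κ M)
    (hfam : ∀ κ M, κ₀ ≤ κ → Mof κ ≤ M → ∀ (P : B12.RunParams) (k : ℕ) (v : Fin (k + 1) → ℝ),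
      v ∈ FlowStep.Box (γ13 κ M) k →
        B13.Lemma1Printed (S13 κ M P k v) (c13 κ M) ∧ B13.Lemma2Printed (S13 κ M P k v) (c13 κ M) ∧
          B13.Lemma3Printed (S13 κ M P k v) (c13 κ M))
    (Δ : ∀ κ M P k, StepDict (T κ M P) (sc κ M) k
      (fun g => S13 κ M P k (Function.update (FlowStep.prefixOf (T κ M P).flow.g k) (Fin.last k) g)))
    (hF : ∀ κ M P k g, (Δ κ M P k).F g =
      (S13 κ M P k (Function.update (FlowStep.prefixOf (T κ M P).flow.g k) (Fin.last k) g)).Etot)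
    (hc : ∀ κ M, κ₀ ≤ κ → Mof κ ≤ M → ConstsCompare (c13 κ M) (sc κ M))
    (hR : ∀ κ M P k v, (S13 κ M P k v).Restr)
    (h26 : ∀ κ M, κ₀ ≤ κ → Mof κ ≤ M → ∀ P k v, B13.CammarotaStep (S13 κ M P k v) (c13 κ M))
    (h22 : ∀ κ M, κ₀ ≤ κ → Mof κ ≤ M → (c13 κ M).R22) (h23 : ∀ κ M, κ₀ ≤ κ → Mof κ ≤ M → (c13 κ M).R23)
    (h24 : ∀ κ M, κ₀ ≤ κ → Mof κ ≤ M → (c13 κ M).R24) (hE₀ : ∀ κ M, κ₀ ≤ κ → Mof κ ≤ M → 0 ≤ (c13 κ M).E₀)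
    (hlog : ∀ κ M, κ₀ ≤ κ → Mof κ ≤ M → ∀ P k v,
      B13.Bound118 (S13 κ M P k v).Dk1 (S13 κ M P k v).sp2 (S13 κ M P k v).Elog ((c13 κ M).E₀ / 2)
        ((c13 κ M).δ₀ * (c13 κ M).M))
    (hrepr : ∀ κ M P k v, (S13 κ M P k v).Repr17)
    (han : ∀ κ M P k v X, (S13 κ M P k v).Analytic ((S13 κ M P k v).Etot X) ((S13 κ M P k v).sp2 X))
    (hg : ∀ κ M P k v X, (S13 κ M P k v).GaugeInv ((S13 κ M P k v).Etot X))
    (hrg : ∀ κ M, κ₀ ≤ κ → Mof κ ≤ M → ∀ P : B12.RunParams, (C (cs κ M) P).flow.SatisfiesRG P.K)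
    (hsp : ∀ κ M, κ₀ ≤ κ → Mof κ ≤ M → ∀ (P : B12.RunParams) (k : ℕ), k < P.K →
      SpacesGaugeInvariant (T κ M P) (sc κ M) (k + 1))
    (hE : ∀ κ M, κ₀ ≤ κ → Mof κ ≤ M → ∀ (P : B12.RunParams) (k : ℕ), k < P.K → B12BetaHolo.EHoloAt (T κ M P) (sc κ M) k)
    (hPi : ∀ κ M, κ₀ ≤ κ → Mof κ ≤ M → ∀ (P : B12.RunParams) (k : ℕ), k < P.K →
      B12BetaHolo.PiHoloSource (T κ M P) (sc κ M) k) :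
    B12.Thm3Printed C :=
  thm3Printed_of_schedule C (fun κ M => (sc κ M).γ) hκ₀ hMof hcs hγ fun κ M hκ hM P =>
    thm3Clause_of_b13Family_eHolo (hD κ M hκ hM P) P.K (hγ κ M hκ hM) (S13 κ M P) (c13 κ M) (hγ13 κ M hκ hM)
      (hfam κ M hκ hM P) (Δ κ M P) (hF κ M P) (hc κ M hκ hM) (hR κ M P) (h26 κ M hκ hM P) (h22 κ M hκ hM)
      (h23 κ M hκ hM) (h24 κ M hκ hM) (hE₀ κ M hκ hM) (hlog κ M hκ hM P) (hrepr κ M P) (han κ M P) (hg κ M P)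
      (hrg κ M hκ hM P) (hsp κ M hκ hM P) (hE κ M hκ hM P) (hPi κ M hκ hM P)

end Towers

/-! ## §5. Theorem 3 ⇒ Theorem 1 at the admissible constants -/

section Thm1

variable (C : B12.Consts3 → B12.Construction)

/-- **THEOREM 3 ⇒ THEOREM 1** (p. 264 *«Now we can formulate a precise version of Theorem 1.»*; Theorem 1 p. 259 *«If the sequence of the
effective coupling constants is contained in an interval ]0, γ] with a sufficiently small positive γ, then the effective actions for
small fields are given by the formulas (0.22)–(0.24), with terms satisfying (0.29).»*): given the reading `IndAss k → Repr k` (the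
inductive assumptions (1.1)–(1.22) at step k contain the representation (0.22)–(0.24) with (0.29), p. 260 (1.3)∕(1.6); `hIncl` of
`B12.thm1_of_thm3_fixedConsts`), `B12.Thm3Printed C` gives `B12.Thm1Printed (C c)` at every admissible choice `c` of the constants,
in the printed quantifier order.  Pure logic. [cite: Balaban1987RG1, Thm 1 p.259 with Thm 3 p.264] -/
theorem thm1Printed_of_thm3Printed (h : B12.Thm3Printed C)
    (hIncl : ∀ (c : B12.Consts3) (P : B12.RunParams) (k : ℕ), (C c P).IndAss k → (C c P).Repr k) :
    ∃ κ₀ : ℝ, 0 < κ₀ ∧ ∀ κ : ℝ, κ₀ ≤ κ → ∃ Mκ : ℝ, 0 < Mκ ∧ ∀ M : ℝ, Mκ ≤ M →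
      ∃ ε₀ ε₁ α₀ α₁ : ℝ, 0 < ε₀ ∧ 0 < ε₁ ∧ 0 < α₀ ∧ 0 < α₁ ∧ B12.Thm1Printed (C ⟨κ, M, ε₀, ε₁, α₀, α₁⟩) := by
  obtain ⟨κ₀, hκ₀, h⟩ := h
  refine ⟨κ₀, hκ₀, fun κ hκ => ?_⟩
  obtain ⟨Mκ, hMκ, h⟩ := h κ hκ
  refine ⟨Mκ, hMκ, fun M hM => ?_⟩
  obtain ⟨ε₀, ε₁, α₀, α₁, hε₀, hε₁, hα₀, hα₁, γ, hγ, h⟩ := h M hM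
  exact ⟨ε₀, ε₁, α₀, α₁, hε₀, hε₁, hα₀, hα₁,
    B12.thm1_of_thm3_fixedConsts C ⟨κ, M, ε₀, ε₁, α₀, α₁⟩ γ hγ h (hIncl _)⟩

end Thm1

end Literature.MathematicalPhysics.QuantumFieldTheory.Balaban1983to89.B12Thm3Assembly
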